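import Summits.NavierStokesRegularity.NavierStokesRegularity.Theorems.EpisodeBaseT.Negative.RingPusherMirrorAnchorSign
import Summits.NavierStokesRegularity.FluidComputer.PalasekTowerTameCarrierAt
import HarnessLib

/-!
# Of a far pusher and its `z`-mirror image, AT MOST ONE strictly anchors an even flat core
# (Negative lane, `EpisodeBaseT`, line «doormirror», stub D2a `SterileSmallCarrierT`)

Cell `ns-blowup`, seat `ns-blowup-refuter4` (g12; D-0074 GROUP C «BRIDGE SUPPORT», Negative lane (α)). Fourth file of the
mirror series (p567521, p569185, p572223), and the general form of p569185 with NO sign computation: p567521's oddness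
`∫ D³Γ(0 − x)(P♭ x, P♭ x, c e₃) = −∫ D³Γ(0 − x)(P x, P x, c e₃)` (`P♭ = M ∘ P ∘ M`) and `anchor_test_iff_fderiv3` give, for an
even core `U₁` (`U₁ 0 = c e₃`, `−ν⟪U₁ 0, ΔU₁ 0⟫ ≥ 0`, support in `B(0, r₁)`) and ANY smooth compactly supported
divergence-free `P` supported in `‖x‖ ≥ r₁`:

* `not_strictAnchor_and_mirror` — `¬ (0 < ⟪(U₁+P) 0, accel ν (U₁+P) 0⟫ ∧ 0 < ⟪(U₁+P♭) 0, accel ν (U₁+P♭) 0⟫)`: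
  the two strict tests read `−ν⟪U₁0,ΔU₁0⟫ < I` and `−ν⟪U₁0,ΔU₁0⟫ < −I`, impossible together when the left side is `≥ 0`.
* `not_levelZeroDataAt_and_mirror` — on the BLOB OF RECORD (`0 < a ≤ 2`, `P` supported in `‖x‖ ≥ 9/2`): the blob with `P`
  and the blob with `P♭` are NOT BOTH `LevelZeroDataAt R · ·` (any radii, any `R`).

Generic transport lemmas for `P♭` (`contDiff_mirrorConj`, `hasCompactSupport_mirrorConj`, `isDivFree_mirrorConj`,
`norm_le_of_mem_tsupport_mirrorConj`) are included. Reading for the stub: the D2a device is CHIRAL — p569185 (ring below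
fails) is the instance `P = ringPusher δ` of this dichotomy combined with p564714's sign; p572223 (mirror-invariant
`P = P♭` ⇒ neither) is its diagonal.

LABEL: kernel analysis (theorems only). WHAT THIS IS NOT: not Navier–Stokes evidence; not a refutation of D2a (a theorem by
name since p569312) or of any route item; no flow, stage, schedule or certificate; sorry-free, std axioms.
bears_on: LADDER-NS N1 (route-NavierStokesRegularity-PalasekTowerBreakdown), item 20303, stub D2a.

References: A. J. Majda, A. L. Bertozzi (CUP 2002) §1.8 Prop. 1.16 [cite: MajdaBertozziCUP2002, §1.8 Prop. 1.16].
-/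

noncomputable section

open Literature.Analysis.FluidPDE
open Summit.NavierStokesRegularity.FluidComputer.PalasekTowerClayBridge
open Summit.NavierStokesRegularity.FluidComputer.PalasekTowerClayBridge.TinyBlob
open Summit.NavierStokesRegularity.FluidComputer.PalasekTowerClayBridge.Germ
open Summit.NavierStokesRegularity.EpisodeBaseTRingPusherMirrorAnchorSign
open MeasureTheory InnerProductSpace Metric Set
open scoped RealInnerProductSpace ContDiff Laplacian

-- nested operator types `ℝ³ →L[ℝ] ℝ³ →L[ℝ] ℝ`
set_option maxSynthPendingDepth 3

namespace Summit.NavierStokesRegularity.EpisodeBaseTMirrorPairAtMostOneAnchors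

variable {P : EuclideanSpace ℝ (Fin 3) → EuclideanSpace ℝ (Fin 3)}

/-! ## §1 Transport of admissibility to the mirrored field `P♭ = M ∘ P ∘ M` -/

/-- `P♭` is smooth if `P` is. [folklore] -/
theorem contDiff_mirrorConj (h : ContDiff ℝ ∞ P) : ContDiff ℝ ∞ (fun y => mirrorZ (P (mirrorZ y))) :=
  mirrorZ.toContinuousLinearEquiv.contDiff.comp (h.comp mirrorZ.toContinuousLinearEquiv.contDiff)

/-- `P♭` has compact support if `P` has. [folklore] -/
theorem hasCompactSupport_mirrorConj (h : HasCompactSupport P) :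
    HasCompactSupport (fun y => mirrorZ (P (mirrorZ y))) :=
  (h.comp_homeomorph mirrorZ.toHomeomorph).comp_left (g := fun v => mirrorZ v) (map_zero _)

/-- `P♭` is divergence free if `P` is. [folklore] -/
theorem isDivFree_mirrorConj (h : VectorCalculus.IsDivFree P) :
    VectorCalculus.IsDivFree (fun y => mirrorZ (P (mirrorZ y))) := by
  have h' := h.conj_linearIsometryEquiv mirrorZ
  rw [mirrorZ_symm] at h'
  exact h'

/-- On the support of `P♭`, `‖x‖` obeys every lower bound valid on the support of `P` (`‖M x‖ = ‖x‖`). [folklore] -/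
theorem norm_le_of_mem_tsupport_mirrorConj {r : ℝ} (hfar : ∀ x ∈ tsupport P, r ≤ ‖x‖)
    {x : EuclideanSpace ℝ (Fin 3)} (hx : x ∈ tsupport (fun y => mirrorZ (P (mirrorZ y)))) : r ≤ ‖x‖ := by
  have hcl : IsClosed {y : EuclideanSpace ℝ (Fin 3) | r ≤ ‖y‖} := isClosed_le continuous_const continuous_norm
  refine (closure_minimal (fun y hy => ?_) hcl) hx
  have hne : P (mirrorZ y) ≠ 0 := fun h0 => hy (by simp [h0])
  have hmem : mirrorZ y ∈ tsupport P := subset_tsupport _ hne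
  have := hfar _ hmem
  rwa [mirrorZ.norm_map] at this

/-! ## §2 The dichotomy -/

/-- **AT MOST ONE OF `P`, `P♭` STRICTLY ANCHORS AN EVEN CORE.** `U₁ ∈ C_c^∞` divergence free, even about `0`,
`tsupport U₁ ⊆ B(0, r₁)`, `U₁ 0 = c e₃`, `−ν⟪U₁ 0, ΔU₁ 0⟫ ≥ 0`; `P ∈ C_c^∞` divergence free with `tsupport P ⊆ {‖x‖ ≥ r₁}`.
Then the strict anchors of `U₁ + P` and `U₁ + P♭` at `0` do not BOTH hold. [cite: MajdaBertozziCUP2002, §1.8 Prop. 1.16] -/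
theorem not_strictAnchor_and_mirror {ν : ℝ} {U₁ : EuclideanSpace ℝ (Fin 3) → EuclideanSpace ℝ (Fin 3)}
    (h₁ : ContDiff ℝ ∞ U₁) (h₁c : HasCompactSupport U₁) (hdiv₁ : VectorCalculus.IsDivFree U₁) (he : IsEvenAbout 0 U₁)
    {r₁ : ℝ} (hr₁ : 0 < r₁) (hsupp : tsupport U₁ ⊆ ball (0 : EuclideanSpace ℝ (Fin 3)) r₁)
    (h₂ : ContDiff ℝ ∞ P) (h₂c : HasCompactSupport P) (hdiv₂ : VectorCalculus.IsDivFree P)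
    (hfarP : ∀ x ∈ tsupport P, r₁ ≤ ‖x‖) {c : ℝ} (hU0 : U₁ 0 = c • e₃) (hΔ : 0 ≤ -(ν * ⟪U₁ 0, (Δ U₁) 0⟫)) :
    ¬ (0 < ⟪(U₁ + P) 0, accel ν (U₁ + P) 0⟫ ∧
        0 < ⟪(U₁ + fun y => mirrorZ (P (mirrorZ y))) 0, accel ν (U₁ + fun y => mirrorZ (P (mirrorZ y))) 0⟫) := by
  rintro ⟨hpos, hpos'⟩
  have hP0 : P 0 = 0 := image_eq_zero_of_notMem_tsupport fun h0 => by
    have := hfarP 0 h0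
    rw [norm_zero] at this
    linarith
  -- admissibility of `P♭`
  have h₂' := contDiff_mirrorConj h₂
  have h₂c' := hasCompactSupport_mirrorConj h₂c
  have hdiv₂' := isDivFree_mirrorConj hdiv₂
  have hfarP' : ∀ x ∈ tsupport (fun y => mirrorZ (P (mirrorZ y))), r₁ ≤ ‖x‖ :=
    fun x hx => norm_le_of_mem_tsupport_mirrorConj hfarP hx
  -- geometry shared by both
  have hd : Disjoint (tsupport U₁) (tsupport P) :=
    disjoint_left.2 fun x hx₁ hx₂ => (not_le.2 (mem_ball_zero_iff.1 (hsupp hx₁))) (hfarP x hx₂)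
  have hd' : Disjoint (tsupport U₁) (tsupport (fun y => mirrorZ (P (mirrorZ y)))) :=
    disjoint_left.2 fun x hx₁ hx₂ => (not_le.2 (mem_ball_zero_iff.1 (hsupp hx₁))) (hfarP' x hx₂)
  have hfar : ∀ x ∈ tsupport P, r₁ / 2 < ‖(0 : EuclideanSpace ℝ (Fin 3)) - x‖ := fun x hx => by
    rw [zero_sub, norm_neg]; linarith [hfarP x hx]
  have hfar' : ∀ x ∈ tsupport (fun y => mirrorZ (P (mirrorZ y))), r₁ / 2 < ‖(0 : EuclideanSpace ℝ (Fin 3)) - x‖ :=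
    fun x hx => by rw [zero_sub, norm_neg]; linarith [hfarP' x hx]
  have hr2 : (0 : ℝ) < r₁ / 2 := by linarith
  -- the two tests as integral inequalities
  have h1 := (anchor_test_iff_fderiv3 (ν := ν) h₁ h₁c hdiv₁ he h₂ h₂c hdiv₂ hd hr2 hfar).1 hpos
  have h1' := (anchor_test_iff_fderiv3 (ν := ν) h₁ h₁c hdiv₁ he h₂' h₂c' hdiv₂' hd' hr2 hfar').1 hpos'
  -- oddness of the integral under the mirror
  have hodd : ∫ x, fderiv ℝ (fun w => fderiv ℝ (fun w' => fderiv ℝ newtonKernel w'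
        ((fun y => mirrorZ (P (mirrorZ y))) x)) w ((fun y => mirrorZ (P (mirrorZ y))) x))
        ((0 : EuclideanSpace ℝ (Fin 3)) - x) (U₁ 0) =
      -∫ x, fderiv ℝ (fun w => fderiv ℝ (fun w' => fderiv ℝ newtonKernel w' (P x)) w (P x))
        ((0 : EuclideanSpace ℝ (Fin 3)) - x) (U₁ 0) := by
    rw [hU0]
    exact integral_anchorIntegrand_mirror P hP0 c
  linarith

/-! ## §3 On the blob of record -/

/-- **THE BLOB OF RECORD WITH `P` AND WITH `P♭` ARE NOT BOTH LEVEL-0 DATA** (`0 < a ≤ 2`; `P ∈ C_c^∞` divergence free,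
`tsupport P ⊆ {‖x‖ ≥ 9/2}`; any radii `ρ ρ'`, any rates record `R`). [cite: MajdaBertozziCUP2002, §1.8 Prop. 1.16] -/
theorem not_levelZeroDataAt_and_mirror (R : TowerRates) {a : ℝ} (ha : 0 < a) (ha2 : a ≤ 2)
    (h₂ : ContDiff ℝ ∞ P) (h₂c : HasCompactSupport P) (hdiv₂ : VectorCalculus.IsDivFree P)
    (hfarP : ∀ x ∈ tsupport P, (9 / 2 : ℝ) ≤ ‖x‖) (ρ ρ' : ℝ) :
    ¬ (LevelZeroDataAt R (tinyProfileAt R a + P) ρ ∧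
        LevelZeroDataAt R (tinyProfileAt R a + fun y => mirrorZ (P (mirrorZ y))) ρ') := by
  rintro ⟨hL, hL'⟩
  obtain ⟨heven, -, hflat⟩ := tinyProfileAt_even_flat R a
  have hsupp : tsupport (tinyProfileAt R a) ⊆ ball (0 : EuclideanSpace ℝ (Fin 3)) (9 / 2) := fun x hx => by
    have h := tsupport_tinyProfileAt_subset (R := R) ha hx
    rw [mem_closedBall, dist_zero_right] at h
    rw [mem_ball, dist_zero_right]
    linarith
  have hΔ : 0 ≤ -(1 * ⟪tinyProfileAt R a 0, (Δ (tinyProfileAt R a)) 0⟫) := by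
    rw [hflat, inner_zero_right, mul_zero, neg_zero]
  have hP0 : P 0 = 0 := image_eq_zero_of_notMem_tsupport fun h0 => by
    have := hfarP 0 h0
    rw [norm_zero] at this
    linarith
  have hU0 : ‖(tinyProfileAt R a + P) 0‖ = R.Y 0 := by
    rw [Pi.add_apply, hP0, add_zero]; exact (tinyProfileAt_zero R a).2
  have hU0' : ‖(tinyProfileAt R a + fun y => mirrorZ (P (mirrorZ y))) 0‖ = R.Y 0 := by
    rw [Pi.add_apply, map_zero, hP0, map_zero, add_zero]; exact (tinyProfileAt_zero R a).2
  exact not_strictAnchor_and_mirror (ν := 1) (contDiff_tinyProfileAt R a) (hasCompactSupport_tinyProfileAt ha)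
    (isDivFree_tinyProfileAt ha.ne') heven (by norm_num : (0 : ℝ) < 9 / 2) hsupp h₂ h₂c hdiv₂ hfarP
    (tinyProfileAt_zero R a).1 hΔ ⟨hL.anchor 0 hU0, hL'.anchor 0 hU0'⟩

end Summit.NavierStokesRegularity.EpisodeBaseTMirrorPairAtMostOneAnchors

end
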